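import Summits.CriticalPhenomena.PercolationContinuityZ3.Theorems.PercNearOneGluingNoHeavyLowerTailFKExactEval
import Summits.CriticalPhenomena.PercolationContinuityZ3.Theorems.PercNearOneGluingNoHeavyLowerTailFKCSHPhiDefs
import HarnessLib

/-!
# `q = 1/2`: comparison in the edge parameters FAILS for a connectivity event, and Lemma Φ(b) FAILS — `¬ FK.PhiFKMonotone (1/2)`

Helper file (`--supports stmt-CriticalPhenomena-4575 --as helper`), FK sub-lane `prim-bschramm-fk-3` ("locate the `q`-sensitivity"); builds
on p205010 (kernel theorem, internal audit signed; external expert review pending).  No named facts, no sorries; standard axioms; all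
numbers are exact rationals decided by the kernel through the bridge `FK.RCEval` (`…FKExactEval.lean`).

THE WITNESS (found by this seat's exact census engine `code-g4/phi_all.py` of `FK.PhiFKMonotone` AS TYPED, cell type `proper|Y0`,
`n = 4`, `q = 1/2`; the census finds no violation on `3` vertices in any palette): the 4-cycle `0–1–2–3–0` with parameters `1/2` plus the two
diagonals `02, 13` with parameter `1/20` (data `c4`), and the same graph with the three pairs at the vertex `2` given parameter `0`
(data `c4z = c4.zero {12, 23, 02}`), cluster weight `q = 1/2`, observer `0`, increasing event `A = {0 ↔ 1} ∪ {0 ↔ 3}`: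

  `φ_{c4}(A) = 26644/30201 ≈ 0.8822 < φ_{c4z}(A) = 164/185 ≈ 0.8865`   (difference `−23824/5587185`, the census value).

1. **Comparison in `𝐩` fails below `q = 1`** (`FK.rcMeasureW_half_not_mono_weights`): `c4z.w ≤ c4.w` pointwise, `A` is increasing,
   yet `φ_{c4z.w,1/2}(A) > φ_{c4.w,1/2}(A)` — LOWERING three edge parameters RAISES the probability of the connection event `{0 ↔ {1,3}}`.
   So the hypothesis `1 ≤ q` of `rcMeasureW_real_mono_weights` (Grimmett 2006 Thm. (3.21)) is sharp, and — complementing fk-2 g6's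
   finding that TWO-POINT connection probabilities appear monotone in every single edge parameter for all `q > 0` (`FK.EdgeConnMonoFK`,
   census-clean) — the event `{o ↔ A}`, `|A| = 2`, of the additive-gluing chain is NOT monotone in the parameters for `q < 1`.
2. **Lemma Φ(b) fails below `q = 1`** (`FK.not_phiFKMonotone_half : ¬ FK.PhiFKMonotone (1/2)`): with `x = 0`, `Y = ∅` (no avoided set:
   the worlds of `FK.worldMeanY` are all `φ` itself) and the increasing cluster functional `g(C) = 1{C has an edge at 1 or at 3}`
   (`= 1_A` on the cluster of `0`), `Φ_FK(K) = E_φ[g] − E_{φ_{G−K̄}}[g(C_0)]`, so `Φ_FK(∅) = 0 > Φ_FK({2}) = 26644/30201 − 164/185`.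
   Hence the hypothesis `1 ≤ q` of fk-1's `FK.phiFKMonotone_of_one_le` (= (M), the located statement whose proof closed the FK finite
   leg for `q ≥ 1`, bschramm/FK-BARRIER.md §8) is SHARP; bschramm/FK-BARRIER.md §7–§8 record that every `q = 1/2` census cell type of (M) fires.
Also recorded: the general bridge lemmas `RCEval.zero` / `RCEval.delW_eq_zero_w` (deleting listed pairs = zeroing their parameters, for
the worlds `rcMeasureW (delW w ·) q ∅` of the FK files) and `FK.exists_mem_openEdgeCluster_iff` (a vertex `v ≠ s` carries an edge of the
open edge cluster `C_s` iff `s ↔ v`).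
[cite: Grimmett2006, Thm. (3.21) and §3.9; §1.4 eq. (1.20) (p. 15)] [cite: VandenbergHaggstromKahn2005, §2.1 Lemmas 2.3–2.4 (p. 10); §1 p. 3]
-/

namespace Summit.CriticalPhenomena.PercolationContinuityZ3.Theorems

namespace FK

open MeasureTheory Literature.Probability.LatticeModels Literature.Probability.Percolation
open Literature.Probability.Percolation.BHK2006 (delW delW_le)

/-! ### Two more bridge lemmas: zeroing listed pairs; vertices of the open edge cluster -/

namespace RCEval

/-- The data with the listed pairs in `J` given parameter `0` (deleted; reducible). [cite: VandenbergHaggstromKahn2005, §2.1 Lemma 2.3 (p. 10) (`G − F̄`)] -/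
abbrev zero (D : RCEval) (J : Finset (Fin D.m)) : RCEval :=
  ⟨D.n, D.m, D.src, D.dst, fun i => if i ∈ J then 0 else D.c i, D.q⟩

/-- Zeroing preserves validity. [folklore] -/
theorem zero_valid {D : RCEval} (hD : D.Valid) (J : Finset (Fin D.m)) : (D.zero J).Valid := by
  refine ⟨hD.1, fun i => ?_, hD.2.2⟩
  change 0 ≤ (if i ∈ J then (0 : ℚ) else D.c i) ∧ (if i ∈ J then (0 : ℚ) else D.c i) ≤ 1
  split_ifs
  · exact ⟨le_rfl, zero_le_one⟩
  · exact hD.2.1 i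

/-- **Deleting pairs = zeroing parameters**: if the listed pairs lying in `A` are exactly those indexed by `J`, then
`delW D.w A = (D.zero J).w` (unlisted pairs have parameter `0` on both sides). [cite: VandenbergHaggstromKahn2005, §2.1 Lemma 2.3 (p. 10)] -/
theorem delW_eq_zero_w {D : RCEval} (hD : D.Valid) {A : Set (Sym2 (Fin D.n))} {J : Finset (Fin D.m)}
    (hA : ∀ i, D.edge i ∈ A ↔ i ∈ J) : delW D.w A = (D.zero J).w := by
  classical
  funext e
  apply Subtype.ext
  unfold delW
  by_cases he : e ∈ Set.range D.edge
  · obtain ⟨i, rfl⟩ := he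
    have hw : ((D.zero J).w (D.edge i) : ℝ) = ((if i ∈ J then (0 : ℚ) else D.c i : ℚ) : ℝ) := w_edge (zero_valid hD J) i
    rw [hw]
    by_cases hi : i ∈ J
    · rw [if_pos ((hA i).2 hi), if_pos hi, Rat.cast_zero]; rfl
    · rw [if_neg (fun h => hi ((hA i).1 h)), if_neg hi, w_edge hD i]
  · have he' : e ∉ Set.range (D.zero J).edge := he
    rw [w_eq_zero_of_notMem_range he']
    split_ifs
    · rfl
    · exact w_eq_zero_of_notMem_range he

end RCEval

/-- **A vertex `v ≠ s` carries an edge of the open edge cluster `C_s` iff `s ↔ v`.** [cite: VandenbergHaggstromKahn2005, §1 p. 3 (definition of C_s)] -/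
theorem exists_mem_openEdgeCluster_iff {V : Type*} (ω : BondConfig V) {s v : V} (hv : v ≠ s) :
    (∃ e ∈ openEdgeCluster ω s, v ∈ e) ↔ (openGraph ω).Reachable s v := by
  constructor
  · rintro ⟨e, he, hve⟩
    exact he.2.2 v hve
  · intro h
    obtain ⟨p⟩ := h.symm
    cases p with
    | nil => exact (hv rfl).elim
    | cons hadj p' =>
      refine ⟨s(v, _), ⟨((openGraph_adj ω _ _).1 hadj).1, ?_, fun z hz => ?_⟩, Sym2.mem_mk_left _ _⟩
      · rw [Sym2.mk_isDiag_iff]; exact hadj.ne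
      · rcases Sym2.mem_iff.1 hz with rfl | rfl
        · exact h
        · exact ⟨p'.reverse⟩

namespace QSensitivity

/-! ### The data -/

/-- The 4-cycle `01, 12, 23, 03` with parameters `1/2` and the diagonals `02, 13` with parameter `1/20`, cluster weight `q` (reducible).
(transcription of bschramm/FK-BARRIER.md §9, census witness of code-g4/phi_all.py) -/
abbrev c4 (q : ℚ) : RCEval := ⟨4, 6, ![0, 1, 2, 0, 0, 1], ![1, 2, 3, 3, 2, 3], ![1 / 2, 1 / 2, 1 / 2, 1 / 2, 1 / 20, 1 / 20], q⟩

/-- The same data with the three pairs at the vertex `2` (`12, 23, 02`, indices `1, 2, 4`) given parameter `0` (reducible).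
(transcription of bschramm/FK-BARRIER.md §9) -/
abbrev c4z (q : ℚ) : RCEval := (c4 q).zero {1, 2, 4}

/-! ### Kernel arithmetic (`decide +kernel`, 64 configurations each) -/

/-- Validity at `q = 1/2`. [folklore] -/
theorem c4_half_valid : (c4 (1 / 2)).Valid := by decide +kernel

/-- `Z(c4; q = 1/2) = 30201/102400`. (transcription of bschramm/FK-BARRIER.md §9) -/
theorem zq_c4_half : (c4 (1 / 2)).ZQ = 30201 / 102400 := by decide +kernel

/-- Mass of `{0 ↔ 1} ∪ {0 ↔ 3}` under `c4`, `q = 1/2`: `6661/25600` (probability `26644/30201`). (transcription of bschramm/FK-BARRIER.md §9) -/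
theorem mass_c4_half :
    (c4 (1 / 2)).massQ (fun t => (c4 (1 / 2)).reachB t 0 1 || (c4 (1 / 2)).reachB t 0 3) = 6661 / 25600 := by
  decide +kernel

/-- `Z(c4z; q = 1/2) = 37/256`. (transcription of bschramm/FK-BARRIER.md §9) -/
theorem zq_c4z_half : (c4z (1 / 2)).ZQ = 37 / 256 := by decide +kernel

/-- Mass of `{0 ↔ 1} ∪ {0 ↔ 3}` under `c4z`, `q = 1/2`: `41/320` (probability `164/185`). (transcription of bschramm/FK-BARRIER.md §9) -/
theorem mass_c4z_half :
    (c4z (1 / 2)).massQ (fun t => (c4z (1 / 2)).reachB t 0 1 || (c4z (1 / 2)).reachB t 0 3) = 41 / 320 := by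
  decide +kernel

/-! ### From masses to the measure -/

noncomputable section

open scoped Classical

/-- The increasing connection event `{0 ↔ 1} ∪ {0 ↔ 3}` on `Fin 4`. [cite: KozmaNitzan2024, Conj. 1 (p. 3) (the event `o ↔ A`)] -/
def A13 : Set (BondConfig (Fin 4)) := openConn 0 1 ∪ openConn 0 3

/-- `A13` is increasing. [folklore] -/
theorem isUpperSet_A13 : IsUpperSet A13 := by
  intro a b hab ha
  have hle : openGraph a ≤ openGraph b := fun x y hxy =>
    (openGraph_adj b x y).2 ⟨hab ((openGraph_adj a x y).1 hxy).1, ((openGraph_adj a x y).1 hxy).2⟩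
  rcases ha with ha | ha
  · exact Or.inl (ha.mono hle)
  · exact Or.inr (ha.mono hle)

/-- Membership of `conf t` in `A13` is computed by `reachB` (data `c4`). [folklore] -/
theorem c4_conf_mem_A13 (q : ℚ) (t : Finset (Fin 6)) :
    (c4 q).conf t ∈ A13 ↔ ((c4 q).reachB t 0 1 || (c4 q).reachB t 0 3) = true := by
  rw [Bool.or_eq_true, RCEval.reachB_iff, RCEval.reachB_iff]; rfl

/-- Membership of `conf t` in `A13` is computed by `reachB` (data `c4z`). [folklore] -/
theorem c4z_conf_mem_A13 (q : ℚ) (t : Finset (Fin 6)) :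
    (c4z q).conf t ∈ A13 ↔ ((c4z q).reachB t 0 1 || (c4z q).reachB t 0 3) = true := by
  rw [Bool.or_eq_true, RCEval.reachB_iff, RCEval.reachB_iff]; rfl

/-- `φ_{c4,1/2}(A13) = 26644/30201`. (transcription of bschramm/FK-BARRIER.md §9) -/
theorem real_c4_half_A13 : (rcMeasureW (c4 (1 / 2)).w (1 / 2) ∅).real A13 = 26644 / 30201 := by
  have h := RCEval.real_eq_massQ_div c4_half_valid (c4_conf_mem_A13 (1 / 2))
  rw [mass_c4_half, zq_c4_half] at h
  have hq : (((c4 (1 / 2)).q : ℚ) : ℝ) = 1 / 2 := by norm_num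
  rw [hq] at h
  rw [h]; norm_num

/-- `φ_{c4z,1/2}(A13) = 164/185`. (transcription of bschramm/FK-BARRIER.md §9) -/
theorem real_c4z_half_A13 : (rcMeasureW (c4z (1 / 2)).w (1 / 2) ∅).real A13 = 164 / 185 := by
  have hv : (c4z (1 / 2)).Valid := RCEval.zero_valid c4_half_valid _
  have h := RCEval.real_eq_massQ_div hv (c4z_conf_mem_A13 (1 / 2))
  rw [mass_c4z_half, zq_c4z_half] at h
  have hq : (((c4z (1 / 2)).q : ℚ) : ℝ) = 1 / 2 := by norm_num [RCEval.zero]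
  rw [hq] at h
  rw [h]; norm_num

/-- The cluster functional `g(C) = 1{C has an edge at 1 or at 3}` (increasing). (transcription of bschramm/FK-BARRIER.md §9: the up-set `0xfa`) -/
def g13 (C : Set (Sym2 (Fin 4))) : ℝ := if ∃ e ∈ C, (1 : Fin 4) ∈ e ∨ (3 : Fin 4) ∈ e then 1 else 0

/-- `g13` is monotone. [folklore] -/
theorem g13_mono : Monotone g13 := by
  intro S T hST
  unfold g13
  by_cases hS : ∃ e ∈ S, (1 : Fin 4) ∈ e ∨ (3 : Fin 4) ∈ e
  · obtain ⟨e, heS, he⟩ := hS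
    rw [if_pos ⟨e, heS, he⟩, if_pos ⟨e, hST heS, he⟩]
  · rw [if_neg hS]; split_ifs <;> norm_num

/-- On the cluster of `0`, `g13 = 1_{A13}`. [cite: VandenbergHaggstromKahn2005, §1 p. 3 (definition of C_s)] -/
theorem g13_openEdgeCluster (ω : BondConfig (Fin 4)) : g13 (openEdgeCluster ω 0) = if ω ∈ A13 then 1 else 0 := by
  have h : (∃ e ∈ openEdgeCluster ω 0, (1 : Fin 4) ∈ e ∨ (3 : Fin 4) ∈ e) ↔ ω ∈ A13 := by
    constructor
    · rintro ⟨e, he, h1 | h3⟩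
      · exact Or.inl ((exists_mem_openEdgeCluster_iff ω (by decide)).1 ⟨e, he, h1⟩)
      · exact Or.inr ((exists_mem_openEdgeCluster_iff ω (by decide)).1 ⟨e, he, h3⟩)
    · rintro (h | h)
      · obtain ⟨e, he, hm⟩ := (exists_mem_openEdgeCluster_iff ω (show (1 : Fin 4) ≠ 0 by decide)).2 h
        exact ⟨e, he, Or.inl hm⟩
      · obtain ⟨e, he, hm⟩ := (exists_mem_openEdgeCluster_iff ω (show (3 : Fin 4) ≠ 0 by decide)).2 h
        exact ⟨e, he, Or.inr hm⟩
  unfold g13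
  by_cases hA : ω ∈ A13
  · rw [if_pos (h.2 hA), if_pos hA]
  · rw [if_neg (fun h' => hA (h.1 h')), if_neg hA]

/-- On `Fin 4`, `E_μ[g13(C_0)] = μ(A13)`. [folklore] -/
theorem integral_g13_eq_real (μ : Measure (BondConfig (Fin 4))) [IsFiniteMeasure μ] :
    ∫ ω, g13 (openEdgeCluster ω 0) ∂μ = μ.real A13 := by
  simp only [g13_openEdgeCluster]
  have h1 : (fun ω : BondConfig (Fin 4) => if ω ∈ A13 then (1 : ℝ) else 0) = A13.indicator 1 := by
    funext ω; simp only [Set.indicator_apply, Pi.one_apply]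
  rw [h1, integral_indicator_one MeasurableSet.of_discrete]

/-- `E_{c4,1/2}[g13(C_0)] = 26644/30201`. (transcription of bschramm/FK-BARRIER.md §9) -/
theorem integral_g13_c4 : ∫ ω, g13 (openEdgeCluster ω 0) ∂(rcMeasureW (c4 (1 / 2)).w (1 / 2) ∅) = 26644 / 30201 := by
  haveI : IsProbabilityMeasure (rcMeasureW (c4 (1 / 2)).w (1 / 2) ∅) := isProbabilityMeasure_rcMeasureW _ (by norm_num) ∅
  rw [integral_g13_eq_real, real_c4_half_A13]

/-- `E_{c4z,1/2}[g13(C_0)] = 164/185`. (transcription of bschramm/FK-BARRIER.md §9) -/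
theorem integral_g13_c4z : ∫ ω, g13 (openEdgeCluster ω 0) ∂(rcMeasureW (c4z (1 / 2)).w (1 / 2) ∅) = 164 / 185 := by
  haveI : IsProbabilityMeasure (rcMeasureW (c4z (1 / 2)).w (1 / 2) ∅) := isProbabilityMeasure_rcMeasureW _ (by norm_num) ∅
  rw [integral_g13_eq_real, real_c4z_half_A13]

/-- The listed pairs of `c4` meeting the vertex `2` are those indexed by `{1, 2, 4}`. [folklore] -/
theorem c4_edge_mem_edgesOf_two (q : ℚ) :
    ∀ i, (c4 q).edge i ∈ CSH.edgesOf ({2} : Set (Fin 4)) ↔ i ∈ ({1, 2, 4} : Finset (Fin 6)) := by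
  intro i
  fin_cases i <;> simp [CSH.edgesOf, RCEval.edge]

/-- Deleting the pairs at `2` from `c4` gives `c4z`: `delW c4.w (edgesOf {2}) = c4z.w`. [folklore] -/
theorem delW_c4_two : delW (c4 (1 / 2)).w (CSH.edgesOf ({2} : Set (Fin 4))) = (c4z (1 / 2)).w :=
  RCEval.delW_eq_zero_w c4_half_valid (c4_edge_mem_edgesOf_two (1 / 2))

/-- Deleting no pair changes nothing. [folklore] -/
theorem delW_empty' {V : Type*} (w : Sym2 V → unitInterval) : delW w ∅ = w := by
  funext e; simp [delW]

/-- With no avoided set the world mean is the plain mean: `worldMeanY w q x ∅ g ω = ∫ g(C_x) dφ_{w,q}`.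
[cite: VandenbergHaggstromKahn2005, §2.1 Lemma 2.3 (p. 10)] -/
theorem worldMeanY_empty {V : Type*} [Fintype V] (w : Sym2 V → unitInterval) (q : ℝ) (x : V) (g : Set (Sym2 V) → ℝ)
    (ω : BondConfig V) : worldMeanY w q x ∅ g ω = ∫ η, g (openEdgeCluster η x) ∂(rcMeasureW w q ∅) := by
  unfold worldMeanY
  have h : {e : Sym2 V | ∃ z ∈ e, ∃ y ∈ (∅ : Set V), (openGraph ω).Reachable y z} = ∅ :=
    Set.eq_empty_of_forall_notMem fun e ⟨_, _, y, hy, _⟩ => hy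
  rw [h, delW_empty']

/-- **With no avoided set, `Φ_FK(K) = E_φ[g(C_x)] − E_{φ_{G−K̄}}[g(C_x)]`** (`q > 0`). [cite: VandenbergHaggstromKahn2005, §2.1 Lemmas 2.3–2.4 (p. 10)] -/
theorem phiFK_empty {V : Type*} [Fintype V] (w : Sym2 V → unitInterval) {q : ℝ} (hq : 0 < q) (x : V) (g : Set (Sym2 V) → ℝ)
    (K : Set V) : phiFK w q x ∅ g K = (∫ η, g (openEdgeCluster η x) ∂(rcMeasureW w q ∅)) -
      ∫ ω, g (openEdgeCluster ω x) ∂(rcMeasureW (delW w (CSH.edgesOf K)) q ∅) := by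
  unfold phiFK
  haveI : IsProbabilityMeasure (rcMeasureW (delW w (CSH.edgesOf K)) q ∅) := isProbabilityMeasure_rcMeasureW _ hq ∅
  have hD : {ω : BondConfig V | ∀ y ∈ (∅ : Set V), ¬ (openGraph ω).Reachable x y} = Set.univ :=
    Set.eq_univ_of_forall fun ω y hy => (Set.notMem_empty y hy).elim
  rw [hD, Measure.restrict_univ]
  simp only [worldMeanY_empty]
  rw [integral_sub (integrable_const _) Integrable.of_finite, integral_const, probReal_univ, one_smul]

end

end QSensitivity

/-! ### The two located statements -/

noncomputable section

open scoped Classical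
open QSensitivity

/-- **Comparison in the edge parameters FAILS for `φ_{w,q}` with `q = 1/2`**: on `Fin 4`, `c4z.w ≤ c4.w` pointwise and `A13 = {0↔1} ∪ {0↔3}`
is increasing, yet `φ_{c4z.w,1/2}(A13) = 164/185 > 26644/30201 = φ_{c4.w,1/2}(A13)` — the hypothesis `1 ≤ q` of `rcMeasureW_real_mono_weights`
(Grimmett 2006 Thm. (3.21)) is sharp, and the gluing chain's event `{o ↔ A}` is not monotone in `𝐩` below `q = 1`.
[cite: Grimmett2006, Thm. (3.21) and §3.9] -/
theorem rcMeasureW_half_not_mono_weights :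
    (∀ e, (c4z (1 / 2)).w e ≤ (c4 (1 / 2)).w e) ∧ IsUpperSet A13 ∧
    (rcMeasureW (c4 (1 / 2)).w (1 / 2) ∅).real A13 < (rcMeasureW (c4z (1 / 2)).w (1 / 2) ∅).real A13 := by
  refine ⟨fun e => ?_, isUpperSet_A13, ?_⟩
  · rw [← delW_c4_two]; exact delW_le _ _ e
  · rw [real_c4_half_A13, real_c4z_half_A13]; norm_num

/-- **LEMMA Φ(b) FAILS for `φ_{w,q}` with `q = 1/2`: `¬ FK.PhiFKMonotone (1/2)`.**  Witness: data `c4` (4-cycle `1/2`, diagonals `1/20`),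
`x = 0`, `Y = ∅`, `g = g13`, `K = ∅ ⊆ K' = {2}`: `Φ_FK(∅) = 0 > Φ_FK({2}) = 26644/30201 − 164/185`.  So `1 ≤ q` in fk-1's
`FK.phiFKMonotone_of_one_le` is sharp. (transcription of bschramm/FK-BARRIER.md §9; census witness of code-g4/phi_all.py, type `proper|Y0`)
[cite: VandenbergHaggstromKahn2005, §2.1 Lemmas 2.3–2.4 (p. 10)] [cite: Grimmett2006, Thm. (3.21) and §3.9] -/
theorem not_phiFKMonotone_half : ¬ PhiFKMonotone (1 / 2) := by
  intro h
  have hmono := h 4 (c4 (1 / 2)).w 0 ∅ g13 g13_mono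
  have key : phiFK (c4 (1 / 2)).w (1 / 2) 0 ∅ g13 ∅ ≤ phiFK (c4 (1 / 2)).w (1 / 2) 0 ∅ g13 {2} :=
    hmono (Set.empty_subset _)
  rw [phiFK_empty _ (by norm_num), phiFK_empty _ (by norm_num)] at key
  have h0 : CSH.edgesOf (∅ : Set (Fin 4)) = ∅ := Set.eq_empty_of_forall_notMem fun e ⟨_, _, hu⟩ => hu
  rw [h0, delW_empty', delW_c4_two, integral_g13_c4, integral_g13_c4z] at key
  norm_num at key

end

end FK

end Summit.CriticalPhenomena.PercolationContinuityZ3.Theorems
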